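import Literature.MathematicalPhysics.QuantumFieldTheory.Balaban1983to89.B9Eq324DeltaPrimeAZd

/-!
# `Balaban1983to89.B9Eq342CombesThomasFormZd` — [Balaban1985BackgroundPropagators] (3.42) p. 399 ∕ Thm 3.1 p. 397 ∕ Thm 3.11 p. 416, the KERNEL DECAY OF AN
# INVERSE FROM A LOWER FORM BOUND: the Combes–Thomas argument IN THE CURRENCY OF THE `ℤᵈ` CARRIER `L²(Ω₀, ·)` of the J-N06→N05 junction
# (`B9Eq321LandauProjectionZd.suppSub ∕ formE`, fibre pairing `Re τ(a* b)` of `B9Eq324DeltaPrimeAZd.fibreForm`) — for an ℝ-linear operator `T` of `L²(Ω₀, ·)`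
# with a COERCIVITY constant `c·⟨f,f⟩_τ ≤ ⟨f, Tf⟩_τ`, FINITE RANGE `r` and block bound `a`, every solution of `Tg = δ_y w` satisfies
# `|g(x)|_τ ≤ e^{−κ·dist(x,y)}·|w|_τ ∕ (c − aN(e^{κr} − 1))`

statement-level skeleton of published theorems with citation tags; proofs where landed; nothing here is a claim about the
Yang–Mills mass gap

`[Balaban1985BackgroundPropagators]` ("B9", CMP **99** (1985) 389–434): Thm 3.1 p. 397 and (3.42) p. 397 *«|(G′(U)λ)(x)| ≦ B₀(Lʲη)²e^{−δ₀d(y,y′)}|λ| for x ∈ Δ(y), y ∈ Λ_j, supp λ ⊂ Δ(y′)»* — the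
exponential decay of the kernels of the inverses `G′ = (Δ′_a)⁻¹`, `G = Δ_a⁻¹`; Thm 3.11 p. 416 *«the operators Δ′_a, G′, (Q′G′²Q′*)⁻¹, Δ_a, G are positive definite»*;
[Balaban1984PropagatorsII] p. 226 *«the operator Δ_a is bounded from below by a positive constant»*.  Print proves the decay by the random-walk expansions of
Sects. B–C; the route's substitute at a FINITE member is the Combes–Thomas conjugation `T ↦ e^{κρ}Te^{−κρ}` ([folklore]; [Balaban1988RG2Cluster] (2.5)–(2.7)
pp. 12–13 use the same device), already in the tree for SCALAR matrices (`B13Sqrt27AccretiveAlmostLocal.almostLocal_inverse_decay`,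
`Analysis.OperatorTheory.CombesThomasBanded`, `Beta.CombesThomasForm`, N10's `B13GreenCentreDecayOfCoercive` at `M_N(ℂ)` on the torus record).  THIS FILE types it
ONCE for the `ℤᵈ` frame's own carrier — `𝔸`-valued site functions supported in the finite `Ω₀ = s`, a general finite-dimensional C*-fibre `𝔸` with a
faithful Hermitian trace functional `τ` (dag-n06-w4 g0∕g2's `suppSub`, `formE`, `fibreForm`, `single`, `restrictSite`) — so that the inverses made OBJECTS there
(`B9Eq324DeltaPrimeAZd.GpZd = G′(U₀)`, `B9Eq327GreenZd.gopZd = G(U₀)`) receive (3.42)-type kernel bounds from ONE displayed form bound, with constants that do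
not see the volume `|Ω₀|`.

CITATION HEADER (lean-in-tree rule).  Cell `pub-ymgap` (YM Track A, HUMAN RULING D-0062 ∕ D-0149 width push), DAG node N06 = [B9], width seat
`pub-ymgap-dag-n06-w2` (g4), CLAIM-1 FILE A («Combes–Thomas at the ℤᵈ frame, station 1»).  Inputs BY NAME: `suppSub ∕ formE ∕ formE_apply ∕
formE_apply_self_eq_zero` (dag-n06-w4 g0), `fibreForm ∕ single ∕ eq_sum_single ∕ restrictSite ∕ finiteDimensional_suppSub'` (dag-n06-w4 g2).  Nothing restated.

WHAT IS DECLARED ∕ PROVED (kernel, 0 sorry; three small definitions with bodies + theorems; no `instance`, no `notation`).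
* §1 `fnorm τ a := √(Re τ(a*a))` (the fibre size `|a|_τ`), `fnorm_sq`, `fnorm_smul`, ★ `abs_fibreForm_le` (Cauchy–Schwarz for `Re τ(a*b)`, faithful Hermitian `τ`),
  `fnorm_add_le`, `fnorm_sum_le`, `fnorm_eq_zero_iff`.
* §2 on `L²(Ω₀, ·)`: `formE_self_eq_sum_sq` (`⟨f,f⟩_τ = Σ_{x∈s} |f(x)|²_τ`), `formE_self_nonneg'`, `fnorm_apply_le` (`|f(x)|_τ ≤ √⟨f,f⟩_τ`), ★ `abs_formE_le`
  (Cauchy–Schwarz for `⟨·,·⟩_τ`), `formE_single_self` (`⟨δ_y w, δ_y w⟩_τ = |w|²_τ`).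
* §3 `scaleFn s ω f` (multiplication by a real site function `ω` — the conjugation weights `e^{±κρ}`), `blockAt s T y w x := (T(δ_y w))(x)` (the `(x, y)` block of
  `T` applied to `w`), `blockAt_smul`, ★ `apply_eq_sum_blockAt` (`(Tf)(x) = Σ_{y∈s} T_{xy} f(y)` — FIELD-linearity read through `eq_sum_single`).
* §4 ★★ `abs_formE_conj_sub_le` — THE SCHUR BOUND OF THE CONJUGATION ERROR: for a weight `ρ` that is 1-Lipschitz for a symmetric `dist`, range `r` (`T_{xy} = 0` for
  `dist(x,y) > r`), block bound `|T_{xy}w|_τ ≤ a|w|_τ` and ball count `#{y ∈ s : dist(x,y) ≤ r} ≤ N`: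
  `|⟨f, e^{κρ}T(e^{−κρ}f)⟩_τ − ⟨f, Tf⟩_τ| ≤ aN(e^{κr} − 1)·⟨f,f⟩_τ`.
* §5 ★★ `bijective_of_coercive` (`c > 0`, `c⟨f,f⟩_τ ≤ ⟨f,Tf⟩_τ` ⟹ `T` bijective; finite dimension) and ★★★ `fnorm_apply_le_exp_of_coercive` — THE COMBES–THOMAS BOUND:
  `Tg = δ_y w`, `y ∈ s` ⟹ `|g(x)|_τ ≤ e^{−κ·dist(x,y)}·|w|_τ ∕ (c − aN(e^{κr} − 1))` for every `κ ≥ 0` with `aN(e^{κr} − 1) < c` — (3.42)'s n = 0 SHAPE for `T⁻¹`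
  with `O(1) = 1∕(c − ϱ)` and rate `κ`, uniformly in `s`.
* §6 the ALMOST-LOCAL form (exponentially localised blocks, the currency of the later stations `Q′G′²Q′*`, `R`, `Δ_a`): ★★ `abs_formE_conj_sub_le_of_rowcol`
  (Schur bound from `(e^{κ·dist} − 1)`-weighted row∕column sums `≤ ϱ` of a block majorant `A`) and ★★★ `fnorm_apply_le_exp_of_coercive_of_rowcol`
  (`ϱ < c` ⟹ `|g(x)|_τ ≤ e^{−κ·dist(x,y)}·|w|_τ ∕ (c − ϱ)`).

HONEST SCOPE.  [folklore] finite-dimensional linear algebra (Cauchy–Schwarz, a Schur test, one conjugation); NO estimate of [B9] is proved here — the coercivity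
constant `c` is a HYPOTHESIS (print: Thm 3.11 ∕ [4] p. 226, via Sect. B), the range∕block∕count data are hypotheses (FILE B of this claim supplies them for
`Δ′_a(U₀)` of (3.24)); the rate is whatever the window `aN(e^{κr} − 1) < c` allows, NOT print's `δ₀`.  Count-neutral; N05 ∕ N06 NOT discharged; K1⁷
`stmt-QuantumFields-20542` NOT closed; one finite `𝕋⁴` programme at fixed `ε`, Bałaban as printed; R4 closes only the conditional finite-`𝕋⁴` rung
`BalabanLadder.UV` — nothing continuum ∕ ℝ⁴ ∕ OS ∕ mass gap ∕ Clay.  Unit `pub-ymgap-dag-n06-w2` (g4), 2026-08-28.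
-/

noncomputable section

open scoped BigOperators

namespace Literature.MathematicalPhysics.QuantumFieldTheory.Balaban1983to89.B9Eq342CombesThomasFormZd

open B9Eq321LandauProjectionZd (suppSub formE formE_apply formE_apply_self_eq_zero)
open B9Eq324DeltaPrimeAZd (fibreForm fibreForm_apply fibreForm_comm single eq_sum_single restrictSite restrictSite_coe finiteDimensional_suppSub')

-- `Site` alone could resolve to the torus sites of `Setup.lean`; re-export the `ℤ^d` sites of `B7Prop1Explicit`.
export B7Prop1Explicit (Site)

variable {d : ℕ} {𝔸 : Type*} [CStarAlgebra 𝔸] (τ : 𝔸 →ₗ[ℂ] ℂ)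

/-! ## §1  The fibre size `|a|_τ = √(Re τ(a*a))` and Cauchy–Schwarz for `Re τ(a*b)` -/

section Fibre

/-- **THE FIBRE SIZE `|a|_τ := √(Re τ(a* a))`** (print's `|X| = (tr X*X)^{1/2}`). [cite: Balaban1985BackgroundPropagators, p.390 («|X|² = tr X*X»)] -/
def fnorm (a : 𝔸) : ℝ := Real.sqrt ((τ (star a * a)).re)

/-- `0 ≤ |a|_τ`. [cite: Balaban1985BackgroundPropagators, p.390 (bookkeeping)] -/
theorem fnorm_nonneg (a : 𝔸) : 0 ≤ fnorm τ a := Real.sqrt_nonneg _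

variable {τ}

/-- each diagonal term `Re τ(a* a)` is non-negative for a faithful positive `τ`. [folklore] [cite: Balaban1985BackgroundPropagators, p.390 («|X|² = tr X*X»; bookkeeping)] -/
private theorem re_trace_star_mul_self_nonneg (hτp : ∀ a : 𝔸, a ≠ 0 → 0 < (τ (star a * a)).re) (a : 𝔸) : 0 ≤ (τ (star a * a)).re := by
  by_cases ha : a = 0
  · rw [ha, mul_zero, map_zero, Complex.zero_re]
  · exact (hτp a ha).le

/-- `|a|_τ² = Re τ(a* a)`. [cite: Balaban1985BackgroundPropagators, p.390 («|X|² = tr X*X»)] -/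
theorem fnorm_sq (hτp : ∀ a : 𝔸, a ≠ 0 → 0 < (τ (star a * a)).re) (a : 𝔸) : fnorm τ a ^ 2 = (τ (star a * a)).re :=
  Real.sq_sqrt (re_trace_star_mul_self_nonneg hτp a)

/-- `|a|_τ² = fibreForm τ a a`. [cite: Balaban1985BackgroundPropagators, p.390 (bookkeeping)] -/
theorem fnorm_sq_eq_fibreForm (hτp : ∀ a : 𝔸, a ≠ 0 → 0 < (τ (star a * a)).re) (a : 𝔸) : fnorm τ a ^ 2 = fibreForm τ a a := by
  rw [fnorm_sq hτp, fibreForm_apply]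

/-- `|a|_τ = 0 ↔ a = 0` (faithful `τ`). [cite: Balaban1985BackgroundPropagators, p.390 (bookkeeping)] -/
theorem fnorm_eq_zero_iff (hτp : ∀ a : 𝔸, a ≠ 0 → 0 < (τ (star a * a)).re) (a : 𝔸) : fnorm τ a = 0 ↔ a = 0 := by
  constructor
  · intro h
    by_contra ha
    have h2 := fnorm_sq hτp a
    rw [h, sq, zero_mul] at h2
    exact (hτp a ha).ne' h2.symm
  · intro h
    rw [h, fnorm, mul_zero, map_zero, Complex.zero_re, Real.sqrt_zero]

variable (τ) in
/-- `Re τ((c•a)* (c•a)) = c² Re τ(a*a)` for real `c`. [folklore] [cite: Balaban1985BackgroundPropagators, p.390 (bookkeeping)] -/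
theorem re_trace_smul_self (c : ℝ) (a : 𝔸) : (τ (star (c • a) * (c • a))).re = c ^ 2 * (τ (star a * a)).re := by
  rw [star_smul, star_trivial, smul_mul_assoc, mul_smul_comm, smul_smul, ← Complex.coe_smul, map_smul, smul_eq_mul,
    Complex.re_ofReal_mul, sq]

variable (τ) in
/-- `|c • a|_τ = |c|·|a|_τ` for real `c`. [cite: Balaban1985BackgroundPropagators, p.390 (bookkeeping)] -/
theorem fnorm_smul (c : ℝ) (a : 𝔸) : fnorm τ (c • a) = |c| * fnorm τ a := by
  rw [fnorm, re_trace_smul_self, Real.sqrt_mul (sq_nonneg c), Real.sqrt_sq_eq_abs, fnorm]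

/-- **CAUCHY–SCHWARZ FOR A SYMMETRIC NON-NEGATIVE REAL BILINEAR FORM**: `|B u v| ≤ √(B u u)·√(B v v)` (the discriminant of `t ↦ B(u − tv, u − tv) ≥ 0`).
[folklore] [cite: Balaban1985BackgroundPropagators, p.391 («natural L² scalar products»; bookkeeping)] -/
theorem abs_bilin_le_sqrt_mul_sqrt {V : Type*} [AddCommGroup V] [Module ℝ V] (B : LinearMap.BilinForm ℝ V)
    (hsymm : ∀ u v, B u v = B v u) (hnn : ∀ v, 0 ≤ B v v) (u v : V) :
    |B u v| ≤ Real.sqrt (B u u) * Real.sqrt (B v v) := by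
  have hquad : ∀ t : ℝ, 0 ≤ B v v * (t * t) + (-(2 * B u v)) * t + B u u := by
    intro t
    have h := hnn (u - t • v)
    have hexp : B (u - t • v) (u - t • v) = B u u - t * B u v - t * B v u + t * t * B v v := by
      simp only [map_sub, map_smul, LinearMap.sub_apply, LinearMap.smul_apply, smul_eq_mul]
      ring
    rw [hexp, hsymm v u] at h
    linarith
  have hdisc := discrim_le_zero hquad
  rw [discrim] at hdisc
  have hsq : (B u v) ^ 2 ≤ B u u * B v v := by nlinarith [hdisc]
  calc |B u v| ≤ Real.sqrt (B u u * B v v) := Real.abs_le_sqrt hsq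
    _ = Real.sqrt (B u u) * Real.sqrt (B v v) := Real.sqrt_mul (hnn u) _

/-- ★ **CAUCHY–SCHWARZ IN THE FIBRE**: `|Re τ(a* b)| ≤ |a|_τ·|b|_τ` (faithful Hermitian `τ`). [cite: Balaban1985BackgroundPropagators, p.391 («natural L² scalar products»)] -/
theorem abs_fibreForm_le (hτp : ∀ a : 𝔸, a ≠ 0 → 0 < (τ (star a * a)).re) (hτs : ∀ a : 𝔸, τ (star a) = starRingEnd ℂ (τ a)) (a b : 𝔸) :
    |(τ (star a * b)).re| ≤ fnorm τ a * fnorm τ b := by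
  have h := abs_bilin_le_sqrt_mul_sqrt (fibreForm τ) (fibreForm_comm τ hτs) (fun v => re_trace_star_mul_self_nonneg hτp v) a b
  simpa only [fibreForm_apply, fnorm] using h

/-- **TRIANGLE INEQUALITY** `|a + b|_τ ≤ |a|_τ + |b|_τ`. [cite: Balaban1985BackgroundPropagators, p.390 (bookkeeping)] -/
theorem fnorm_add_le (hτp : ∀ a : 𝔸, a ≠ 0 → 0 < (τ (star a * a)).re) (hτs : ∀ a : 𝔸, τ (star a) = starRingEnd ℂ (τ a)) (a b : 𝔸) :
    fnorm τ (a + b) ≤ fnorm τ a + fnorm τ b := by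
  have hab := abs_fibreForm_le hτp hτs a b
  have hba : (τ (star b * a)).re = (τ (star a * b)).re := by
    rw [← fibreForm_apply, ← fibreForm_apply, fibreForm_comm τ hτs]
  have hexp : (τ (star (a + b) * (a + b))).re = (τ (star a * a)).re + 2 * (τ (star a * b)).re + (τ (star b * b)).re := by
    rw [star_add, add_mul, mul_add, mul_add, map_add, map_add, map_add, Complex.add_re, Complex.add_re, Complex.add_re, hba]
    ring
  rw [fnorm, Real.sqrt_le_left (add_nonneg (fnorm_nonneg τ a) (fnorm_nonneg τ b)), hexp, add_sq, fnorm_sq hτp, fnorm_sq hτp]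
  nlinarith [hab, abs_le.mp (le_of_eq rfl : |(τ (star a * b)).re| ≤ |(τ (star a * b)).re|), le_abs_self ((τ (star a * b)).re)]

/-- `|0|_τ = 0`. [cite: Balaban1985BackgroundPropagators, p.390 (bookkeeping)] -/
theorem fnorm_zero : fnorm τ (0 : 𝔸) = 0 := by
  rw [fnorm, mul_zero, map_zero, Complex.zero_re, Real.sqrt_zero]

/-- `|Σ_i a_i|_τ ≤ Σ_i |a_i|_τ`. [cite: Balaban1985BackgroundPropagators, p.390 (bookkeeping)] -/
theorem fnorm_sum_le (hτp : ∀ a : 𝔸, a ≠ 0 → 0 < (τ (star a * a)).re) (hτs : ∀ a : 𝔸, τ (star a) = starRingEnd ℂ (τ a))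
    {ι : Type*} (S : Finset ι) (g : ι → 𝔸) : fnorm τ (∑ i ∈ S, g i) ≤ ∑ i ∈ S, fnorm τ (g i) := by
  classical
  induction S using Finset.induction_on with
  | empty => rw [Finset.sum_empty, Finset.sum_empty, fnorm_zero]
  | insert i S hi ih =>
    rw [Finset.sum_insert hi, Finset.sum_insert hi]
    exact (fnorm_add_le hτp hτs _ _).trans (by linarith)

end Fibre

/-! ## §2  On `L²(Ω₀, ·)`: `⟨f,f⟩_τ = Σ_x |f(x)|²_τ`, pointwise bound, Cauchy–Schwarz, the single-site function -/

section Carrier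

variable {τ} {s : Finset (Site d)}

/-- `⟨f,f⟩_τ = Σ_{x∈s} |f(x)|²_τ`. [cite: Balaban1985BackgroundPropagators, (3.21) p.394 («L²(Ω₀, 𝔤)»)] -/
theorem formE_self_eq_sum_sq (hτp : ∀ a : 𝔸, a ≠ 0 → 0 < (τ (star a * a)).re) (f : suppSub (𝔸 := 𝔸) s) :
    formE τ s f f = ∑ x ∈ s, fnorm τ ((f : Site d → 𝔸) x) ^ 2 := by
  rw [formE_apply]
  exact Finset.sum_congr rfl fun x _ => (fnorm_sq hτp _).symm

/-- `0 ≤ ⟨f,f⟩_τ`. [cite: Balaban1985BackgroundPropagators, (3.21) p.394 (bookkeeping)] -/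
theorem formE_self_nonneg' (hτp : ∀ a : 𝔸, a ≠ 0 → 0 < (τ (star a * a)).re) (f : suppSub (𝔸 := 𝔸) s) : 0 ≤ formE τ s f f := by
  rw [formE_self_eq_sum_sq hτp]
  exact Finset.sum_nonneg fun x _ => sq_nonneg _

/-- **POINTWISE BOUND** `|f(x)|_τ ≤ √⟨f,f⟩_τ`. [cite: Balaban1985BackgroundPropagators, (3.21) p.394 (bookkeeping)] -/
theorem fnorm_apply_le (hτp : ∀ a : 𝔸, a ≠ 0 → 0 < (τ (star a * a)).re) (f : suppSub (𝔸 := 𝔸) s) (x : Site d) :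
    fnorm τ ((f : Site d → 𝔸) x) ≤ Real.sqrt (formE τ s f f) := by
  by_cases hx : x ∈ s
  · rw [Real.le_sqrt (fnorm_nonneg τ _) (formE_self_nonneg' hτp f), formE_self_eq_sum_sq hτp]
    exact Finset.single_le_sum (f := fun y => fnorm τ ((f : Site d → 𝔸) y) ^ 2) (fun y _ => sq_nonneg _) hx
  · rw [f.2 x hx, fnorm_zero]
    exact Real.sqrt_nonneg _

/-- ★ **CAUCHY–SCHWARZ FOR `⟨·,·⟩_τ`**: `|⟨f,g⟩_τ| ≤ √⟨f,f⟩_τ·√⟨g,g⟩_τ` (faithful Hermitian `τ`). [cite: Balaban1985BackgroundPropagators, p.391 («natural L² scalar products»)] -/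
theorem abs_formE_le (hτp : ∀ a : 𝔸, a ≠ 0 → 0 < (τ (star a * a)).re) (hτs : ∀ a : 𝔸, τ (star a) = starRingEnd ℂ (τ a))
    (f g : suppSub (𝔸 := 𝔸) s) : |formE τ s f g| ≤ Real.sqrt (formE τ s f f) * Real.sqrt (formE τ s g g) :=
  abs_bilin_le_sqrt_mul_sqrt (formE τ s) (fun u v => (B9Eq321LandauProjectionZd.formE_isSymm τ s hτs).eq u v)
    (fun v => formE_self_nonneg' hτp v) f g

/-- the single-site function `δ_y w` lies in `L²(Ω₀, ·)` for `y ∈ Ω₀`: `restrictSite s (single y w)` has underlying function `single y w`.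
[cite: Balaban1985BackgroundPropagators, (3.21) p.394 (bookkeeping)] -/
theorem restrictSite_single_coe {y : Site d} (hy : y ∈ s) (w : 𝔸) :
    (restrictSite s (single y w) : Site d → 𝔸) = single y w := by
  rw [restrictSite_coe]
  funext x
  by_cases hx : x ∈ (↑s : Set (Site d))
  · rw [Set.indicator_of_mem hx]
  · rw [Set.indicator_of_notMem hx]
    have hxy : x ≠ y := fun h => hx (by rw [h]; exact Finset.mem_coe.mpr hy)
    simp [single, hxy]

/-- `restrictSite s f = f` for `f ∈ L²(Ω₀, ·)`. [cite: Balaban1985BackgroundPropagators, (3.24) p.394 («↾Ω₀»; bookkeeping)] -/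
theorem restrictSite_of_mem (f : suppSub (𝔸 := 𝔸) s) : restrictSite s (f : Site d → 𝔸) = f := by
  apply Subtype.ext
  rw [restrictSite_coe]
  funext x
  by_cases hx : x ∈ (↑s : Set (Site d))
  · rw [Set.indicator_of_mem hx]
  · rw [Set.indicator_of_notMem hx, f.2 x (fun h => hx (Finset.mem_coe.mpr h))]

/-- `single y w` evaluated: `w` at `y`, `0` elsewhere. [cite: Balaban1985BackgroundPropagators, (3.24) p.394 (bookkeeping)] -/
theorem single_apply_self (y : Site d) (w : 𝔸) : single y w y = w := by simp [single]

/-- `single y w x = 0` for `x ≠ y`. [cite: Balaban1985BackgroundPropagators, (3.24) p.394 (bookkeeping)] -/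
theorem single_apply_of_ne {x y : Site d} (h : x ≠ y) (w : 𝔸) : single y w x = 0 := by simp [single, h]

/-- `⟨δ_y w, δ_y w⟩_τ = |w|²_τ` for `y ∈ Ω₀`. [cite: Balaban1985BackgroundPropagators, (3.21) p.394 (bookkeeping)] -/
theorem formE_single_self (hτp : ∀ a : 𝔸, a ≠ 0 → 0 < (τ (star a * a)).re) {y : Site d} (hy : y ∈ s) (w : 𝔸) :
    formE τ s (restrictSite s (single y w)) (restrictSite s (single y w)) = fnorm τ w ^ 2 := by
  rw [formE_self_eq_sum_sq hτp, restrictSite_single_coe hy, Finset.sum_eq_single_of_mem y hy]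
  · rw [single_apply_self]
  · intro x _ hxy
    rw [single_apply_of_ne hxy, fnorm_zero, sq, zero_mul]

end Carrier

/-! ## §3  Multiplication by real site functions; the blocks `T_{xy}` of an operator of `L²(Ω₀, ·)` -/

section Blocks

variable (s : Finset (Site d))

/-- **MULTIPLICATION BY A REAL SITE FUNCTION** `ω` on `L²(Ω₀, ·)` (the conjugation weights `e^{±κρ}` of the Combes–Thomas argument).
[cite: Balaban1988RG2Cluster, (2.7) p.13 (the conjugation); Balaban1985BackgroundPropagators, (3.42) p.397] -/
def scaleFn (ω : Site d → ℝ) (f : suppSub (𝔸 := 𝔸) s) : suppSub (𝔸 := 𝔸) s :=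
  ⟨fun x => ω x • (f : Site d → 𝔸) x, fun x hx => by simp only [f.2 x hx, smul_zero]⟩

/-- `scaleFn`, unfolded. [cite: Balaban1988RG2Cluster, (2.7) p.13 (bookkeeping)] -/
@[simp] theorem scaleFn_coe (ω : Site d → ℝ) (f : suppSub (𝔸 := 𝔸) s) (x : Site d) :
    (scaleFn s ω f : Site d → 𝔸) x = ω x • (f : Site d → 𝔸) x := rfl

variable {s} in
/-- multiplication of a single-site function is a scalar multiple: `ω·δ_y w = δ_y (ω(y) w)`. [cite: Balaban1988RG2Cluster, (2.7) p.13 (bookkeeping)] -/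
theorem scaleFn_restrictSite_single (ω : Site d → ℝ) {y : Site d} (hy : y ∈ s) (w : 𝔸) :
    scaleFn s ω (restrictSite s (single y w)) = restrictSite s (single y (ω y • w)) := by
  apply Subtype.ext
  funext x
  rw [scaleFn_coe, restrictSite_single_coe hy, restrictSite_single_coe hy]
  by_cases hxy : x = y
  · subst hxy; rw [single_apply_self, single_apply_self]
  · rw [single_apply_of_ne hxy, single_apply_of_ne hxy, smul_zero]

variable (T : suppSub (𝔸 := 𝔸) s →ₗ[ℝ] suppSub (𝔸 := 𝔸) s)

/-- **THE `(x, y)` BLOCK OF `T` APPLIED TO `w`**: `T_{xy}w := (T(δ_y w))(x)`. [cite: Balaban1985BackgroundPropagators, (3.42) p.397 (kernels «G(U; x, y)»)] -/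
def blockAt (y : Site d) (w : 𝔸) (x : Site d) : 𝔸 :=
  (T (restrictSite s (single y w)) : Site d → 𝔸) x

/-- `blockAt`, unfolded. [cite: Balaban1985BackgroundPropagators, (3.42) p.397 (bookkeeping)] -/
theorem blockAt_def (y : Site d) (w : 𝔸) (x : Site d) : blockAt s T y w x = (T (restrictSite s (single y w)) : Site d → 𝔸) x := rfl

/-- the block is ℝ-linear in `w`: `T_{xy}(c•w) = c•T_{xy}w`. [cite: Balaban1985BackgroundPropagators, (3.42) p.397 (bookkeeping)] -/
theorem blockAt_smul (y : Site d) (c : ℝ) (w : 𝔸) (x : Site d) : blockAt s T y (c • w) x = c • blockAt s T y w x := by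
  rw [blockAt, blockAt, B9Eq324DeltaPrimeAZd.single_smul, map_smul, map_smul, Submodule.coe_smul, Pi.smul_apply]

/-- the block vanishes off `Ω₀` in `x`. [cite: Balaban1985BackgroundPropagators, (3.24) p.394 («↾Ω₀»; bookkeeping)] -/
theorem blockAt_eq_zero_of_not_mem (y : Site d) (w : 𝔸) {x : Site d} (hx : x ∉ s) : blockAt s T y w x = 0 :=
  (T (restrictSite s (single y w))).2 x hx

variable {s T} in
/-- ★ **FIELD-LINEARITY READ THROUGH THE SINGLE-SITE DECOMPOSITION**: `(Tf)(x) = Σ_{y∈s} T_{xy} f(y)` for `f ∈ L²(Ω₀, ·)`.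
[cite: Balaban1985BackgroundPropagators, (3.42) p.397 (the kernel of an operator), (3.24) p.394] -/
theorem apply_eq_sum_blockAt (f : suppSub (𝔸 := 𝔸) s) (x : Site d) :
    (T f : Site d → 𝔸) x = ∑ y ∈ s, blockAt s T y ((f : Site d → 𝔸) y) x := by
  have hS : ∀ k, (f : Site d → 𝔸) k ≠ 0 → k ∈ s := fun k hk => by
    by_contra hks; exact hk (f.2 k hks)
  have hf : f = ∑ y ∈ s, restrictSite s (single y ((f : Site d → 𝔸) y)) := by
    rw [← map_sum, ← eq_sum_single hS, restrictSite_of_mem]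
  conv_lhs => rw [hf, map_sum]
  rw [AddSubmonoidClass.coe_finsetSum, Finset.sum_apply]
  rfl

variable {s T} in
/-- the same for the scaled field: `(T(ω·f))(x) = Σ_{y∈s} ω(y)·T_{xy} f(y)`. [cite: Balaban1988RG2Cluster, (2.7) p.13 (bookkeeping)] -/
theorem apply_scaleFn_eq_sum_blockAt (ω : Site d → ℝ) (f : suppSub (𝔸 := 𝔸) s) (x : Site d) :
    (T (scaleFn s ω f) : Site d → 𝔸) x = ∑ y ∈ s, ω y • blockAt s T y ((f : Site d → 𝔸) y) x := by
  rw [apply_eq_sum_blockAt]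
  exact Finset.sum_congr rfl fun y _ => by rw [scaleFn_coe, blockAt_smul]

end Blocks

/-! ## §4  The Schur bound of the conjugation error `e^{κρ}Te^{−κρ} − T` -/

section Schur

variable {τ} {s : Finset (Site d)} {T : suppSub (𝔸 := 𝔸) s →ₗ[ℝ] suppSub (𝔸 := 𝔸) s}

/-- `|e^{t} − 1| ≤ e^{|t|} − 1`. [folklore] [cite: Balaban1988RG2Cluster, (2.7) p.13 (bookkeeping of the conjugation weights)] -/
private theorem abs_exp_sub_one_le_exp_abs_sub_one (t : ℝ) : |Real.exp t - 1| ≤ Real.exp |t| - 1 := by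
  rcases le_or_gt 0 t with ht | ht
  · rw [abs_of_nonneg ht, abs_of_nonneg (by linarith [Real.one_le_exp ht])]
  · rw [abs_of_neg ht, abs_of_neg (by linarith [Real.exp_lt_one_iff.mpr ht])]
    have h1 := Real.add_one_le_exp t
    have h2 := Real.add_one_le_exp (-t)
    have h3 : Real.exp t * Real.exp (-t) = 1 := by rw [← Real.exp_add, add_neg_cancel, Real.exp_zero]
    nlinarith [Real.exp_pos t, Real.exp_pos (-t)]

/-- the conjugation factor: `|e^{κ(ρx − ρy)} − 1| ≤ e^{κr} − 1` when `|ρx − ρy| ≤ dist(x,y) ≤ r`, `κ ≥ 0`. [folklore]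
[cite: Balaban1988RG2Cluster, (2.7) p.13] -/
theorem abs_exp_weight_sub_one_le {κ r : ℝ} (hκ : 0 ≤ κ) {ρx ρy dxy : ℝ} (hρ : |ρx - ρy| ≤ dxy) (hd : dxy ≤ r) :
    |Real.exp (κ * (ρx - ρy)) - 1| ≤ Real.exp (κ * r) - 1 := by
  refine (abs_exp_sub_one_le_exp_abs_sub_one _).trans ?_
  rw [abs_mul, abs_of_nonneg hκ]
  have : κ * |ρx - ρy| ≤ κ * r := mul_le_mul_of_nonneg_left (hρ.trans hd) hκ
  linarith [Real.exp_le_exp.mpr this]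

/-- **THE DISCRETE SCHUR ∕ AM–GM STEP**: for non-negative `A` on `s`, a symmetric `dist` and ball count `#{y ∈ s : dist(x,y) ≤ r} ≤ N`,
`Σ_{x,y∈s, dist(x,y) ≤ r} A(x)A(y) ≤ N·Σ_{x∈s} A(x)²` (AM–GM termwise, then the two marginal counts). [folklore]
[cite: Balaban1988RG2Cluster, (2.16) p.16 (row and column sums; bookkeeping)] -/
theorem sum_sum_ball_mul_le {dist : Site d → Site d → ℝ} (hds : ∀ x y, dist x y = dist y x) {r : ℝ} {N : ℕ}
    (hN : ∀ x ∈ s, (s.filter (fun y => dist x y ≤ r)).card ≤ N) (A : Site d → ℝ) :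
    ∑ x ∈ s, ∑ y ∈ s, (if dist x y ≤ r then A x * A y else 0) ≤ N * ∑ x ∈ s, A x ^ 2 := by
  classical
  have hstep : ∀ x ∈ s, ∀ y ∈ s, (if dist x y ≤ r then A x * A y else 0) ≤
      (if dist x y ≤ r then A x ^ 2 / 2 else 0) + (if dist x y ≤ r then A y ^ 2 / 2 else 0) := by
    intro x _ y _
    split_ifs
    · nlinarith [sq_nonneg (A x - A y)]
    · simp
  have h1 : ∀ x ∈ s, ∑ y ∈ s, (if dist x y ≤ r then A x ^ 2 / 2 else 0) ≤ N * (A x ^ 2 / 2) := by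
    intro x hx
    rw [← Finset.sum_filter, Finset.sum_const, nsmul_eq_mul]
    exact mul_le_mul_of_nonneg_right (by exact_mod_cast hN x hx) (by positivity)
  have h2 : ∀ y ∈ s, ∑ x ∈ s, (if dist x y ≤ r then A y ^ 2 / 2 else 0) ≤ N * (A y ^ 2 / 2) := by
    intro y hy
    have hfilt : (s.filter (fun x => dist x y ≤ r)) = s.filter (fun x => dist y x ≤ r) := by
      refine Finset.filter_congr fun x _ => ?_
      rw [hds x y]
    rw [← Finset.sum_filter, Finset.sum_const, nsmul_eq_mul, hfilt]
    exact mul_le_mul_of_nonneg_right (by exact_mod_cast hN y hy) (by positivity)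
  calc ∑ x ∈ s, ∑ y ∈ s, (if dist x y ≤ r then A x * A y else 0)
      ≤ ∑ x ∈ s, ∑ y ∈ s, ((if dist x y ≤ r then A x ^ 2 / 2 else 0) + (if dist x y ≤ r then A y ^ 2 / 2 else 0)) :=
        Finset.sum_le_sum fun x hx => Finset.sum_le_sum fun y hy => hstep x hx y hy
    _ = (∑ x ∈ s, ∑ y ∈ s, if dist x y ≤ r then A x ^ 2 / 2 else 0) + ∑ x ∈ s, ∑ y ∈ s, (if dist x y ≤ r then A y ^ 2 / 2 else 0) := by
        rw [← Finset.sum_add_distrib]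
        exact Finset.sum_congr rfl fun x _ => Finset.sum_add_distrib
    _ = (∑ x ∈ s, ∑ y ∈ s, if dist x y ≤ r then A x ^ 2 / 2 else 0) + ∑ y ∈ s, ∑ x ∈ s, (if dist x y ≤ r then A y ^ 2 / 2 else 0) := by
        congr 1
        exact Finset.sum_comm
    _ ≤ ∑ x ∈ s, N * (A x ^ 2 / 2) + ∑ y ∈ s, N * (A y ^ 2 / 2) := add_le_add (Finset.sum_le_sum h1) (Finset.sum_le_sum h2)
    _ = N * ∑ x ∈ s, A x ^ 2 := by rw [← Finset.mul_sum, ← Finset.sum_div]; ring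

/-- ★★ **THE SCHUR BOUND OF THE CONJUGATION ERROR.**  Let `dist` be symmetric, `ρ` 1-Lipschitz for it, `T` of range `r` (`T_{xy} = 0` for `dist(x,y) > r`) with block
bound `|T_{xy}w|_τ ≤ a|w|_τ` and ball count `N`.  Then for every `f ∈ L²(Ω₀, ·)` and `κ ≥ 0`,
`|⟨f, e^{κρ}T(e^{−κρ}f)⟩_τ − ⟨f, Tf⟩_τ| ≤ aN(e^{κr} − 1)·⟨f, f⟩_τ`.
[cite: Balaban1988RG2Cluster, (2.7) p.13, (2.16) p.16; Balaban1985BackgroundPropagators, (3.42) p.397] -/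
theorem abs_formE_conj_sub_le (hτp : ∀ a : 𝔸, a ≠ 0 → 0 < (τ (star a * a)).re) (hτs : ∀ a : 𝔸, τ (star a) = starRingEnd ℂ (τ a))
    {dist : Site d → Site d → ℝ} (hds : ∀ x y, dist x y = dist y x) {ρ : Site d → ℝ} (hρ : ∀ x y, |ρ x - ρ y| ≤ dist x y)
    {r a κ : ℝ} {N : ℕ} (hr : 0 ≤ r) (ha : 0 ≤ a) (hκ : 0 ≤ κ)
    (hN : ∀ x ∈ s, (s.filter (fun y => dist x y ≤ r)).card ≤ N)
    (hrange : ∀ y ∈ s, ∀ x ∈ s, ∀ w : 𝔸, r < dist x y → blockAt s T y w x = 0)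
    (hblock : ∀ y ∈ s, ∀ x ∈ s, ∀ w : 𝔸, fnorm τ (blockAt s T y w x) ≤ a * fnorm τ w)
    (f : suppSub (𝔸 := 𝔸) s) :
    |formE τ s f (scaleFn s (fun x => Real.exp (κ * ρ x)) (T (scaleFn s (fun x => Real.exp (-(κ * ρ x))) f))) - formE τ s f (T f)| ≤
      a * N * (Real.exp (κ * r) - 1) * formE τ s f f := by
  classical
  set F : Site d → 𝔸 := (f : Site d → 𝔸) with hF
  -- the two pairings as double sums over the blocks
  set B : Site d → Site d → ℝ := fun x y => (τ (star (F x) * blockAt s T y (F y) x)).re with hB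
  have hconj : formE τ s f (scaleFn s (fun x => Real.exp (κ * ρ x)) (T (scaleFn s (fun x => Real.exp (-(κ * ρ x))) f))) =
      ∑ x ∈ s, ∑ y ∈ s, Real.exp (κ * (ρ x - ρ y)) * B x y := by
    rw [formE_apply]
    refine Finset.sum_congr rfl fun x _ => ?_
    rw [scaleFn_coe, apply_scaleFn_eq_sum_blockAt, Finset.smul_sum, Finset.mul_sum, map_sum, Complex.re_sum]
    refine Finset.sum_congr rfl fun y _ => ?_
    rw [smul_smul, ← Real.exp_add, show κ * ρ x + -(κ * ρ y) = κ * (ρ x - ρ y) by ring, hB]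
    dsimp only
    rw [mul_smul_comm, ← Complex.coe_smul, map_smul, smul_eq_mul, Complex.re_ofReal_mul]
  have hplain : formE τ s f (T f) = ∑ x ∈ s, ∑ y ∈ s, B x y := by
    rw [formE_apply]
    refine Finset.sum_congr rfl fun x _ => ?_
    rw [apply_eq_sum_blockAt, Finset.mul_sum, map_sum, Complex.re_sum]
  -- each block pairing: `|B x y| ≤ a |F x| |F y|`, and `= 0` beyond the range
  have hBle : ∀ x ∈ s, ∀ y ∈ s, |B x y| ≤ a * (fnorm τ (F x) * fnorm τ (F y)) := by
    intro x hx y hy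
    calc |B x y| ≤ fnorm τ (F x) * fnorm τ (blockAt s T y (F y) x) := abs_fibreForm_le hτp hτs _ _
      _ ≤ fnorm τ (F x) * (a * fnorm τ (F y)) := mul_le_mul_of_nonneg_left (hblock y hy x hx _) (fnorm_nonneg τ _)
      _ = a * (fnorm τ (F x) * fnorm τ (F y)) := by ring
  have hBfar : ∀ x ∈ s, ∀ y ∈ s, ¬ dist x y ≤ r → B x y = 0 := by
    intro x hx y hy hfar
    simp only [hB, hrange y hy x hx _ (lt_of_not_ge hfar), mul_zero, map_zero, Complex.zero_re]
  -- termwise bound of the difference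
  have hterm : ∀ x ∈ s, ∀ y ∈ s, |Real.exp (κ * (ρ x - ρ y)) * B x y - B x y| ≤
      a * (Real.exp (κ * r) - 1) * (if dist x y ≤ r then fnorm τ (F x) * fnorm τ (F y) else 0) := by
    intro x hx y hy
    by_cases hxy : dist x y ≤ r
    · rw [if_pos hxy, show Real.exp (κ * (ρ x - ρ y)) * B x y - B x y = (Real.exp (κ * (ρ x - ρ y)) - 1) * B x y by ring, abs_mul]
      have h1 := abs_exp_weight_sub_one_le hκ (hρ x y) hxy
      have h2 := hBle x hx y hy
      calc |Real.exp (κ * (ρ x - ρ y)) - 1| * |B x y| ≤ (Real.exp (κ * r) - 1) * (a * (fnorm τ (F x) * fnorm τ (F y))) :=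
            mul_le_mul h1 h2 (abs_nonneg _) (by linarith [abs_nonneg (Real.exp (κ * (ρ x - ρ y)) - 1)])
        _ = a * (Real.exp (κ * r) - 1) * (fnorm τ (F x) * fnorm τ (F y)) := by ring
    · rw [if_neg hxy, hBfar x hx y hy hxy, mul_zero, sub_zero, abs_zero, mul_zero]
  rw [hconj, hplain, ← Finset.sum_sub_distrib]
  calc |∑ x ∈ s, (∑ y ∈ s, Real.exp (κ * (ρ x - ρ y)) * B x y - ∑ y ∈ s, B x y)|
      ≤ ∑ x ∈ s, |∑ y ∈ s, Real.exp (κ * (ρ x - ρ y)) * B x y - ∑ y ∈ s, B x y| := Finset.abs_sum_le_sum_abs _ _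
    _ ≤ ∑ x ∈ s, ∑ y ∈ s, |Real.exp (κ * (ρ x - ρ y)) * B x y - B x y| := Finset.sum_le_sum fun x _ => by
        rw [← Finset.sum_sub_distrib]; exact Finset.abs_sum_le_sum_abs _ _
    _ ≤ ∑ x ∈ s, ∑ y ∈ s, a * (Real.exp (κ * r) - 1) * (if dist x y ≤ r then fnorm τ (F x) * fnorm τ (F y) else 0) :=
        Finset.sum_le_sum fun x hx => Finset.sum_le_sum fun y hy => hterm x hx y hy
    _ = a * (Real.exp (κ * r) - 1) * ∑ x ∈ s, ∑ y ∈ s, (if dist x y ≤ r then fnorm τ (F x) * fnorm τ (F y) else 0) := by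
        rw [Finset.mul_sum]; exact Finset.sum_congr rfl fun x _ => by rw [Finset.mul_sum]
    _ ≤ a * (Real.exp (κ * r) - 1) * (N * ∑ x ∈ s, fnorm τ (F x) ^ 2) := by
        have hexp : 0 ≤ Real.exp (κ * r) - 1 := by linarith [Real.one_le_exp (mul_nonneg hκ hr)]
        refine mul_le_mul_of_nonneg_left ?_ (mul_nonneg ha hexp)
        have h := sum_sum_ball_mul_le (s := s) hds hN (fun x => fnorm τ (F x))
        refine le_trans (le_of_eq (Finset.sum_congr rfl fun x _ => Finset.sum_congr rfl fun y _ => ?_)) h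
        split_ifs <;> rfl
    _ = a * N * (Real.exp (κ * r) - 1) * formE τ s f f := by rw [formE_self_eq_sum_sq hτp]; ring

end Schur

/-! ## §5  Coercive ⟹ bijective; the Combes–Thomas bound for the solution of `Tg = δ_y w` -/

section CombesThomas

variable {τ} {s : Finset (Site d)} {T : suppSub (𝔸 := 𝔸) s →ₗ[ℝ] suppSub (𝔸 := 𝔸) s}

/-- ★★ **COERCIVE ⟹ BIJECTIVE** on `L²(Ω₀, ·)` (finite `Ω₀`, finite-dimensional fibre, faithful `τ`): `c > 0`, `c·⟨f,f⟩_τ ≤ ⟨f, Tf⟩_τ` for all `f` ⟹ `T` injective ⟹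
bijective. (Print: positive definite ⟹ invertible, «hence … G = Δ_a⁻¹».) [cite: Balaban1984PropagatorsII, p.226; Balaban1985BackgroundPropagators, Thm 3.11 p.416] -/
theorem bijective_of_coercive [FiniteDimensional ℝ 𝔸] (hτp : ∀ a : 𝔸, a ≠ 0 → 0 < (τ (star a * a)).re) {c : ℝ} (hc : 0 < c)
    (hco : ∀ f : suppSub (𝔸 := 𝔸) s, c * formE τ s f f ≤ formE τ s f (T f)) : Function.Bijective T := by
  haveI := finiteDimensional_suppSub' (𝔸 := 𝔸) s
  have hinj : Function.Injective T := by
    rw [← LinearMap.ker_eq_bot, Submodule.eq_bot_iff]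
    intro f hf
    rw [LinearMap.mem_ker] at hf
    have h1 := hco f
    rw [hf, map_zero] at h1
    have h2 := formE_self_nonneg' hτp f
    have h3 : formE τ s f f = 0 := by nlinarith
    exact formE_apply_self_eq_zero τ s hτp h3
  exact ⟨hinj, LinearMap.injective_iff_surjective.1 hinj⟩

/-- the weight `ρ = dist(·, y)` is 1-Lipschitz for a symmetric `dist` with the triangle inequality. [folklore] [cite: Balaban1988RG2Cluster, (2.7) p.13 (bookkeeping)] -/
theorem abs_dist_sub_dist_le {dist : Site d → Site d → ℝ} (hds : ∀ x y, dist x y = dist y x)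
    (hdt : ∀ x y z, dist x z ≤ dist x y + dist y z) (y x x' : Site d) : |dist x y - dist x' y| ≤ dist x x' := by
  rw [abs_sub_le_iff]
  constructor
  · have := hdt x x' y; linarith
  · have := hdt x' x y; rw [hds x' x] at this; linarith

/-- ★★★ **THE COMBES–THOMAS BOUND IN THE CURRENCY OF `L²(Ω₀, ·)`.**  Let `dist` be a pseudo-metric on the sites (`dist x x = 0`, symmetric, triangle), `T` an
ℝ-linear operator of `L²(Ω₀, ·)` which is `c`-COERCIVE (`c·⟨f,f⟩_τ ≤ ⟨f,Tf⟩_τ`), of RANGE `r` (`T_{xy} = 0` for `dist(x,y) > r`) with BLOCK BOUND `|T_{xy}w|_τ ≤ a|w|_τ`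
and BALL COUNT `#{y ∈ Ω₀ : dist(x,y) ≤ r} ≤ N`, and let `κ ≥ 0` satisfy `ϱ := aN(e^{κr} − 1) < c`.  Then every solution of `Tg = δ_y w` (`y ∈ Ω₀`) obeys
`|g(x)|_τ ≤ e^{−κ·dist(x,y)}·|w|_τ ∕ (c − ϱ)` at every site `x` — the (3.42) n = 0 shape of the kernel of `T⁻¹`, constants independent of `|Ω₀|`.
PROOF: with `ρ := dist(·,y)` and `g_κ := e^{κρ}g`: `e^{κρ}T(e^{−κρ}g_κ) = e^{κρ}δ_y w = δ_y w` (`ρ(y) = 0`); coercivity and the Schur bound give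
`(c − ϱ)⟨g_κ,g_κ⟩_τ ≤ ⟨g_κ, δ_y w⟩_τ ≤ |g_κ|·|w|_τ`, so `e^{κ dist(x,y)}|g(x)|_τ = |g_κ(x)|_τ ≤ |g_κ| ≤ |w|_τ∕(c − ϱ)`.
[cite: Balaban1985BackgroundPropagators, (3.42) p.397, Thm 3.1 p.397, Thm 3.11 p.416; Balaban1984PropagatorsII, p.226; Balaban1988RG2Cluster, (2.5)–(2.7) pp.12–13] -/
theorem fnorm_apply_le_exp_of_coercive (hτp : ∀ a : 𝔸, a ≠ 0 → 0 < (τ (star a * a)).re) (hτs : ∀ a : 𝔸, τ (star a) = starRingEnd ℂ (τ a))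
    {dist : Site d → Site d → ℝ} (hd0 : ∀ x, dist x x = 0) (hds : ∀ x y, dist x y = dist y x) (hdt : ∀ x y z, dist x z ≤ dist x y + dist y z)
    {c r a κ : ℝ} {N : ℕ} (hr : 0 ≤ r) (ha : 0 ≤ a) (hκ : 0 ≤ κ)
    (hN : ∀ x ∈ s, (s.filter (fun y => dist x y ≤ r)).card ≤ N)
    (hrange : ∀ y ∈ s, ∀ x ∈ s, ∀ w : 𝔸, r < dist x y → blockAt s T y w x = 0)
    (hblock : ∀ y ∈ s, ∀ x ∈ s, ∀ w : 𝔸, fnorm τ (blockAt s T y w x) ≤ a * fnorm τ w)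
    (hco : ∀ f : suppSub (𝔸 := 𝔸) s, c * formE τ s f f ≤ formE τ s f (T f))
    (hϱ : a * N * (Real.exp (κ * r) - 1) < c)
    {g : suppSub (𝔸 := 𝔸) s} {y : Site d} (hy : y ∈ s) {w : 𝔸} (hg : T g = restrictSite s (single y w)) (x : Site d) :
    fnorm τ ((g : Site d → 𝔸) x) ≤ Real.exp (-(κ * dist x y)) / (c - a * N * (Real.exp (κ * r) - 1)) * fnorm τ w := by
  set ϱ : ℝ := a * N * (Real.exp (κ * r) - 1) with hϱdef
  set ρ : Site d → ℝ := fun z => dist z y with hρ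
  have hρL : ∀ z z', |ρ z - ρ z'| ≤ dist z z' := fun z z' => abs_dist_sub_dist_le hds hdt y z z'
  -- the conjugated field `g_κ := e^{κρ} g`
  set gκ : suppSub (𝔸 := 𝔸) s := scaleFn s (fun z => Real.exp (κ * ρ z)) g with hgκ
  have hunscale : scaleFn s (fun z => Real.exp (-(κ * ρ z))) gκ = g := by
    apply Subtype.ext; funext z
    rw [scaleFn_coe, hgκ, scaleFn_coe, smul_smul, ← Real.exp_add, neg_add_cancel, Real.exp_zero, one_smul]
  have hconj : scaleFn s (fun z => Real.exp (κ * ρ z)) (T (scaleFn s (fun z => Real.exp (-(κ * ρ z))) gκ)) = restrictSite s (single y w) := by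
    rw [hunscale, hg, scaleFn_restrictSite_single _ hy]
    simp only [hρ, hd0 y, mul_zero, Real.exp_zero, one_smul]
  -- Schur + coercivity: `(c − ϱ)|g_κ|² ≤ ⟨g_κ, δ_y w⟩`
  have hschur := abs_formE_conj_sub_le (T := T) hτp hτs hds hρL hr ha hκ hN hrange hblock gκ
  rw [hconj] at hschur
  have hcoer := hco gκ
  have hlow : (c - ϱ) * formE τ s gκ gκ ≤ formE τ s gκ (restrictSite s (single y w)) := by
    have h := (abs_sub_le_iff.1 hschur).2
    nlinarith [h, hcoer]
  -- Cauchy–Schwarz: `⟨g_κ, δ_y w⟩ ≤ |g_κ|·|w|`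
  have hcs := (le_abs_self _).trans (abs_formE_le hτp hτs gκ (restrictSite s (single y w)))
  rw [formE_single_self hτp hy, Real.sqrt_sq (fnorm_nonneg τ w)] at hcs
  set X := Real.sqrt (formE τ s gκ gκ) with hX
  have hX0 : 0 ≤ X := Real.sqrt_nonneg _
  have hXsq : X ^ 2 = formE τ s gκ gκ := Real.sq_sqrt (formE_self_nonneg' hτp gκ)
  have hcϱ : 0 < c - ϱ := by rw [hϱdef]; linarith
  -- `(c − ϱ) X ≤ |w|`
  have hXle : (c - ϱ) * X ≤ fnorm τ w := by
    have h1 : (c - ϱ) * X ^ 2 ≤ X * fnorm τ w := by rw [hXsq]; exact hlow.trans hcs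
    by_cases hX0' : X = 0
    · rw [hX0', mul_zero]; exact fnorm_nonneg τ w
    · have hXpos : 0 < X := lt_of_le_of_ne hX0 (Ne.symm hX0')
      nlinarith
  -- pointwise: `e^{κ dist(x,y)} |g(x)| = |g_κ(x)| ≤ X`
  have hpt : fnorm τ ((gκ : Site d → 𝔸) x) ≤ X := fnorm_apply_le hτp gκ x
  rw [hgκ, scaleFn_coe, fnorm_smul, abs_of_pos (Real.exp_pos _)] at hpt
  have hexp : 0 < Real.exp (κ * dist x y) := Real.exp_pos _
  rw [Real.exp_neg, div_eq_mul_inv, mul_assoc]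
  rw [show Real.exp (κ * ρ x) = Real.exp (κ * dist x y) by rfl] at hpt
  calc fnorm τ ((g : Site d → 𝔸) x) = (Real.exp (κ * dist x y))⁻¹ * (Real.exp (κ * dist x y) * fnorm τ ((g : Site d → 𝔸) x)) := by
        rw [← mul_assoc, inv_mul_cancel₀ hexp.ne', one_mul]
    _ ≤ (Real.exp (κ * dist x y))⁻¹ * X := mul_le_mul_of_nonneg_left hpt (inv_nonneg.2 hexp.le)
    _ ≤ (Real.exp (κ * dist x y))⁻¹ * ((c - ϱ)⁻¹ * fnorm τ w) := by
        refine mul_le_mul_of_nonneg_left ?_ (inv_nonneg.2 hexp.le)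
        rw [le_inv_mul_iff₀ hcϱ]
        exact hXle

/-- ★★ **THE SAME, FOR THE INVERSE AS A MAP**: with `T` bijective (e.g. `bijective_of_coercive`) and `G := T⁻¹`, `|(G(δ_y w))(x)|_τ ≤ e^{−κ dist(x,y)}|w|_τ∕(c − ϱ)`.
[cite: Balaban1985BackgroundPropagators, (3.42) p.397, Thm 3.1 p.397] -/
theorem fnorm_inv_single_le_exp_of_coercive (hτp : ∀ a : 𝔸, a ≠ 0 → 0 < (τ (star a * a)).re) (hτs : ∀ a : 𝔸, τ (star a) = starRingEnd ℂ (τ a))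
    {dist : Site d → Site d → ℝ} (hd0 : ∀ x, dist x x = 0) (hds : ∀ x y, dist x y = dist y x) (hdt : ∀ x y z, dist x z ≤ dist x y + dist y z)
    {c r a κ : ℝ} {N : ℕ} (hr : 0 ≤ r) (ha : 0 ≤ a) (hκ : 0 ≤ κ)
    (hN : ∀ x ∈ s, (s.filter (fun y => dist x y ≤ r)).card ≤ N)
    (hrange : ∀ y ∈ s, ∀ x ∈ s, ∀ w : 𝔸, r < dist x y → blockAt s T y w x = 0)
    (hblock : ∀ y ∈ s, ∀ x ∈ s, ∀ w : 𝔸, fnorm τ (blockAt s T y w x) ≤ a * fnorm τ w)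
    (hco : ∀ f : suppSub (𝔸 := 𝔸) s, c * formE τ s f f ≤ formE τ s f (T f))
    (hϱ : a * N * (Real.exp (κ * r) - 1) < c)
    (G : suppSub (𝔸 := 𝔸) s → suppSub (𝔸 := 𝔸) s) (hG : ∀ h, T (G h) = h)
    {y : Site d} (hy : y ∈ s) (w : 𝔸) (x : Site d) :
    fnorm τ ((G (restrictSite s (single y w)) : Site d → 𝔸) x) ≤
      Real.exp (-(κ * dist x y)) / (c - a * N * (Real.exp (κ * r) - 1)) * fnorm τ w :=
  fnorm_apply_le_exp_of_coercive hτp hτs hd0 hds hdt hr ha hκ hN hrange hblock hco hϱ hy (hG _) x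

end CombesThomas

/-! ## §6  The almost-local version: exponentially weighted row and column sums instead of a finite range -/

section AlmostLocal

variable {τ} {s : Finset (Site d)} {T : suppSub (𝔸 := 𝔸) s →ₗ[ℝ] suppSub (𝔸 := 𝔸) s}

/-- ★★ **THE SCHUR BOUND OF THE CONJUGATION ERROR, ALMOST-LOCAL FORM** («the operators are exponentially localised rather than of finite range»): with a block
majorant `|T_{xy}w|_τ ≤ A(x,y)|w|_τ` whose `(e^{κ·dist} − 1)`-WEIGHTED ROW AND COLUMN SUMS over `Ω₀` are `≤ ϱ`,
`|⟨f, e^{κρ}T(e^{−κρ}f)⟩_τ − ⟨f, Tf⟩_τ| ≤ ϱ·⟨f,f⟩_τ` for every 1-Lipschitz weight `ρ`.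
[cite: Balaban1988RG2Cluster, (2.7) p.13, p.15, (2.16) p.16; Balaban1985BackgroundPropagators, (3.42) p.397] -/
theorem abs_formE_conj_sub_le_of_rowcol (hτp : ∀ a : 𝔸, a ≠ 0 → 0 < (τ (star a * a)).re) (hτs : ∀ a : 𝔸, τ (star a) = starRingEnd ℂ (τ a))
    {dist : Site d → Site d → ℝ} {ρ : Site d → ℝ} (hρ : ∀ x y, |ρ x - ρ y| ≤ dist x y) {κ ϱ : ℝ} (hκ : 0 ≤ κ)
    (A : Site d → Site d → ℝ) (hA : ∀ x y, 0 ≤ A x y)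
    (hblock : ∀ y ∈ s, ∀ x ∈ s, ∀ w : 𝔸, fnorm τ (blockAt s T y w x) ≤ A x y * fnorm τ w)
    (hrow : ∀ x ∈ s, ∑ y ∈ s, A x y * (Real.exp (κ * dist x y) - 1) ≤ ϱ)
    (hcol : ∀ y ∈ s, ∑ x ∈ s, A x y * (Real.exp (κ * dist x y) - 1) ≤ ϱ)
    (f : suppSub (𝔸 := 𝔸) s) :
    |formE τ s f (scaleFn s (fun x => Real.exp (κ * ρ x)) (T (scaleFn s (fun x => Real.exp (-(κ * ρ x))) f))) - formE τ s f (T f)| ≤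
      ϱ * formE τ s f f := by
  classical
  set F : Site d → 𝔸 := (f : Site d → 𝔸) with hF
  set B : Site d → Site d → ℝ := fun x y => (τ (star (F x) * blockAt s T y (F y) x)).re with hB
  set K : Site d → Site d → ℝ := fun x y => A x y * (Real.exp (κ * dist x y) - 1) with hK
  have hconj : formE τ s f (scaleFn s (fun x => Real.exp (κ * ρ x)) (T (scaleFn s (fun x => Real.exp (-(κ * ρ x))) f))) =
      ∑ x ∈ s, ∑ y ∈ s, Real.exp (κ * (ρ x - ρ y)) * B x y := by
    rw [formE_apply]
    refine Finset.sum_congr rfl fun x _ => ?_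
    rw [scaleFn_coe, apply_scaleFn_eq_sum_blockAt, Finset.smul_sum, Finset.mul_sum, map_sum, Complex.re_sum]
    refine Finset.sum_congr rfl fun y _ => ?_
    rw [smul_smul, ← Real.exp_add, show κ * ρ x + -(κ * ρ y) = κ * (ρ x - ρ y) by ring, hB]
    dsimp only
    rw [mul_smul_comm, ← Complex.coe_smul, map_smul, smul_eq_mul, Complex.re_ofReal_mul]
  have hplain : formE τ s f (T f) = ∑ x ∈ s, ∑ y ∈ s, B x y := by
    rw [formE_apply]
    refine Finset.sum_congr rfl fun x _ => ?_
    rw [apply_eq_sum_blockAt, Finset.mul_sum, map_sum, Complex.re_sum]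
  -- the weight factor: `|e^{κ(ρx − ρy)} − 1| ≤ e^{κ dist(x,y)} − 1`
  have hwt : ∀ x y, |Real.exp (κ * (ρ x - ρ y)) - 1| ≤ Real.exp (κ * dist x y) - 1 := fun x y =>
    abs_exp_weight_sub_one_le hκ (hρ x y) le_rfl
  have hKnn : ∀ x y, 0 ≤ K x y := fun x y =>
    mul_nonneg (hA x y) (by linarith [abs_nonneg (Real.exp (κ * (ρ x - ρ y)) - 1), hwt x y])
  -- termwise: `|(e^{…} − 1) B x y| ≤ K x y |F x| |F y|`
  have hterm : ∀ x ∈ s, ∀ y ∈ s, |Real.exp (κ * (ρ x - ρ y)) * B x y - B x y| ≤ K x y * (fnorm τ (F x) * fnorm τ (F y)) := by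
    intro x hx y hy
    rw [show Real.exp (κ * (ρ x - ρ y)) * B x y - B x y = (Real.exp (κ * (ρ x - ρ y)) - 1) * B x y by ring, abs_mul]
    have hBle : |B x y| ≤ A x y * (fnorm τ (F x) * fnorm τ (F y)) := by
      calc |B x y| ≤ fnorm τ (F x) * fnorm τ (blockAt s T y (F y) x) := abs_fibreForm_le hτp hτs _ _
        _ ≤ fnorm τ (F x) * (A x y * fnorm τ (F y)) := mul_le_mul_of_nonneg_left (hblock y hy x hx _) (fnorm_nonneg τ _)
        _ = A x y * (fnorm τ (F x) * fnorm τ (F y)) := by ring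
    calc |Real.exp (κ * (ρ x - ρ y)) - 1| * |B x y| ≤ (Real.exp (κ * dist x y) - 1) * (A x y * (fnorm τ (F x) * fnorm τ (F y))) :=
          mul_le_mul (hwt x y) hBle (abs_nonneg _) (by linarith [abs_nonneg (Real.exp (κ * (ρ x - ρ y)) - 1), hwt x y])
      _ = K x y * (fnorm τ (F x) * fnorm τ (F y)) := by rw [hK]; ring
  -- AM–GM with the row and column sums
  have hamgm : ∀ x ∈ s, ∀ y ∈ s, K x y * (fnorm τ (F x) * fnorm τ (F y)) ≤ K x y * (fnorm τ (F x) ^ 2 / 2) + K x y * (fnorm τ (F y) ^ 2 / 2) := by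
    intro x _ y _
    have := hKnn x y
    nlinarith [sq_nonneg (fnorm τ (F x) - fnorm τ (F y))]
  rw [hconj, hplain, ← Finset.sum_sub_distrib]
  calc |∑ x ∈ s, (∑ y ∈ s, Real.exp (κ * (ρ x - ρ y)) * B x y - ∑ y ∈ s, B x y)|
      ≤ ∑ x ∈ s, |∑ y ∈ s, Real.exp (κ * (ρ x - ρ y)) * B x y - ∑ y ∈ s, B x y| := Finset.abs_sum_le_sum_abs _ _
    _ ≤ ∑ x ∈ s, ∑ y ∈ s, |Real.exp (κ * (ρ x - ρ y)) * B x y - B x y| := Finset.sum_le_sum fun x _ => by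
        rw [← Finset.sum_sub_distrib]; exact Finset.abs_sum_le_sum_abs _ _
    _ ≤ ∑ x ∈ s, ∑ y ∈ s, (K x y * (fnorm τ (F x) ^ 2 / 2) + K x y * (fnorm τ (F y) ^ 2 / 2)) :=
        Finset.sum_le_sum fun x hx => Finset.sum_le_sum fun y hy => (hterm x hx y hy).trans (hamgm x hx y hy)
    _ = (∑ x ∈ s, ∑ y ∈ s, K x y * (fnorm τ (F x) ^ 2 / 2)) + ∑ x ∈ s, ∑ y ∈ s, K x y * (fnorm τ (F y) ^ 2 / 2) := by
        rw [← Finset.sum_add_distrib]; exact Finset.sum_congr rfl fun x _ => Finset.sum_add_distrib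
    _ = (∑ x ∈ s, (fnorm τ (F x) ^ 2 / 2) * ∑ y ∈ s, K x y) + ∑ y ∈ s, (fnorm τ (F y) ^ 2 / 2) * ∑ x ∈ s, K x y := by
        congr 1
        · exact Finset.sum_congr rfl fun x _ => by rw [Finset.mul_sum]; exact Finset.sum_congr rfl fun y _ => by ring
        · rw [Finset.sum_comm]; exact Finset.sum_congr rfl fun y _ => by rw [Finset.mul_sum]; exact Finset.sum_congr rfl fun x _ => by ring
    _ ≤ ∑ x ∈ s, (fnorm τ (F x) ^ 2 / 2) * ϱ + ∑ y ∈ s, (fnorm τ (F y) ^ 2 / 2) * ϱ :=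
        add_le_add (Finset.sum_le_sum fun x hx => mul_le_mul_of_nonneg_left (hrow x hx) (by positivity))
          (Finset.sum_le_sum fun y hy => mul_le_mul_of_nonneg_left (hcol y hy) (by positivity))
    _ = ϱ * formE τ s f f := by
        rw [formE_self_eq_sum_sq hτp, ← Finset.sum_add_distrib, Finset.mul_sum]
        exact Finset.sum_congr rfl fun x _ => by ring

/-- ★★★ **THE COMBES–THOMAS BOUND, ALMOST-LOCAL FORM**: pseudo-metric `dist`, `c`-coercive `T`, a block majorant `A` with `(e^{κ·dist} − 1)`-weighted row and
column sums `≤ ϱ < c` ⟹ every solution of `Tg = δ_y w` (`y ∈ Ω₀`) obeys `|g(x)|_τ ≤ e^{−κ·dist(x,y)}·|w|_τ ∕ (c − ϱ)` — the currency of the next stations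
(`Q′G′²Q′*`, `R`, `Δ_a`), whose blocks decay exponentially instead of vanishing.
[cite: Balaban1985BackgroundPropagators, (3.42) p.397, Thm 3.1 p.397, Thm 3.11 p.416; Balaban1988RG2Cluster, (2.5)–(2.7) pp.12–13, (2.16) p.16] -/
theorem fnorm_apply_le_exp_of_coercive_of_rowcol (hτp : ∀ a : 𝔸, a ≠ 0 → 0 < (τ (star a * a)).re)
    (hτs : ∀ a : 𝔸, τ (star a) = starRingEnd ℂ (τ a))
    {dist : Site d → Site d → ℝ} (hd0 : ∀ x, dist x x = 0) (hds : ∀ x y, dist x y = dist y x) (hdt : ∀ x y z, dist x z ≤ dist x y + dist y z)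
    {c κ ϱ : ℝ} (hκ : 0 ≤ κ) (A : Site d → Site d → ℝ) (hA : ∀ x y, 0 ≤ A x y)
    (hblock : ∀ y ∈ s, ∀ x ∈ s, ∀ w : 𝔸, fnorm τ (blockAt s T y w x) ≤ A x y * fnorm τ w)
    (hrow : ∀ x ∈ s, ∑ y ∈ s, A x y * (Real.exp (κ * dist x y) - 1) ≤ ϱ)
    (hcol : ∀ y ∈ s, ∑ x ∈ s, A x y * (Real.exp (κ * dist x y) - 1) ≤ ϱ)
    (hco : ∀ f : suppSub (𝔸 := 𝔸) s, c * formE τ s f f ≤ formE τ s f (T f)) (hϱ : ϱ < c)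
    {g : suppSub (𝔸 := 𝔸) s} {y : Site d} (hy : y ∈ s) {w : 𝔸} (hg : T g = restrictSite s (single y w)) (x : Site d) :
    fnorm τ ((g : Site d → 𝔸) x) ≤ Real.exp (-(κ * dist x y)) / (c - ϱ) * fnorm τ w := by
  set ρ : Site d → ℝ := fun z => dist z y with hρ
  have hρL : ∀ z z', |ρ z - ρ z'| ≤ dist z z' := fun z z' => abs_dist_sub_dist_le hds hdt y z z'
  set gκ : suppSub (𝔸 := 𝔸) s := scaleFn s (fun z => Real.exp (κ * ρ z)) g with hgκ
  have hunscale : scaleFn s (fun z => Real.exp (-(κ * ρ z))) gκ = g := by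
    apply Subtype.ext; funext z
    rw [scaleFn_coe, hgκ, scaleFn_coe, smul_smul, ← Real.exp_add, neg_add_cancel, Real.exp_zero, one_smul]
  have hconj : scaleFn s (fun z => Real.exp (κ * ρ z)) (T (scaleFn s (fun z => Real.exp (-(κ * ρ z))) gκ)) = restrictSite s (single y w) := by
    rw [hunscale, hg, scaleFn_restrictSite_single _ hy]
    simp only [hρ, hd0 y, mul_zero, Real.exp_zero, one_smul]
  have hschur := abs_formE_conj_sub_le_of_rowcol (T := T) hτp hτs hρL hκ A hA hblock hrow hcol gκ
  rw [hconj] at hschur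
  have hcoer := hco gκ
  have hlow : (c - ϱ) * formE τ s gκ gκ ≤ formE τ s gκ (restrictSite s (single y w)) := by
    have h := (abs_sub_le_iff.1 hschur).2
    nlinarith [h, hcoer]
  have hcs := (le_abs_self _).trans (abs_formE_le hτp hτs gκ (restrictSite s (single y w)))
  rw [formE_single_self hτp hy, Real.sqrt_sq (fnorm_nonneg τ w)] at hcs
  set X := Real.sqrt (formE τ s gκ gκ) with hX
  have hX0 : 0 ≤ X := Real.sqrt_nonneg _
  have hXsq : X ^ 2 = formE τ s gκ gκ := Real.sq_sqrt (formE_self_nonneg' hτp gκ)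
  have hcϱ : 0 < c - ϱ := by linarith
  have hXle : (c - ϱ) * X ≤ fnorm τ w := by
    have h1 : (c - ϱ) * X ^ 2 ≤ X * fnorm τ w := by rw [hXsq]; exact hlow.trans hcs
    by_cases hX0' : X = 0
    · rw [hX0', mul_zero]; exact fnorm_nonneg τ w
    · have hXpos : 0 < X := lt_of_le_of_ne hX0 (Ne.symm hX0')
      nlinarith
  have hpt : fnorm τ ((gκ : Site d → 𝔸) x) ≤ X := fnorm_apply_le hτp gκ x
  rw [hgκ, scaleFn_coe, fnorm_smul, abs_of_pos (Real.exp_pos _)] at hpt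
  have hexp : 0 < Real.exp (κ * dist x y) := Real.exp_pos _
  rw [Real.exp_neg, div_eq_mul_inv, mul_assoc]
  rw [show Real.exp (κ * ρ x) = Real.exp (κ * dist x y) by rfl] at hpt
  calc fnorm τ ((g : Site d → 𝔸) x) = (Real.exp (κ * dist x y))⁻¹ * (Real.exp (κ * dist x y) * fnorm τ ((g : Site d → 𝔸) x)) := by
        rw [← mul_assoc, inv_mul_cancel₀ hexp.ne', one_mul]
    _ ≤ (Real.exp (κ * dist x y))⁻¹ * X := mul_le_mul_of_nonneg_left hpt (inv_nonneg.2 hexp.le)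
    _ ≤ (Real.exp (κ * dist x y))⁻¹ * ((c - ϱ)⁻¹ * fnorm τ w) := by
        refine mul_le_mul_of_nonneg_left ?_ (inv_nonneg.2 hexp.le)
        rw [le_inv_mul_iff₀ hcϱ]
        exact hXle

end AlmostLocal

end Literature.MathematicalPhysics.QuantumFieldTheory.Balaban1983to89.B9Eq342CombesThomasFormZd

end
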